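import Summits.Parity.GeneralizedHardyLittlewood.Theorems.FordMaynardNoSieveConst0164NegWitness0164HalfPoint

/-!
# Route `FordMaynardNoSieveConst0164`, crux `NegWitness0164` (stmt-Parity-19102), line `birth`,
# stub `stub_tweakNeg0164`: the value at `(1/2, 1/2)` is `≥ -1` (hypothesis (iii) discharged)

Helper file toward the certificate stub (K. Ford, J. Maynard, *On the theory of prime producing sieves*,
arXiv:2407.14368; the cell's inequality (F3) "`f(1/2, 1/2) ≥ -1`").  By `…HalfPoint`
(`hhalf_of_T22_0164`) hypothesis (iii) of `stub_tweakNeg0164_of_shape` follows from `T₂₂ ≥ -4`, where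
`T₂₂ = ∫_{u ∈ Δ₂(1/2)} ∫_{v ∈ Δ₂(1/2)} 𝟙[u, v ≥ ν] w₂(u) w₂(v) F₀⁽⁴⁾(u, v)`, `ν = 41/250`,
`w₂(u) = -1/(2u₀u₁)`.  Here this is PROVED for every `F₀` with `F₀⁽⁴⁾ ≥ -1`:

* `M_le_0164` — `M = ∫_{v ∈ Δ₂(1/2)} 𝟙[v ≥ ν]/(v₀v₁) ≤ 4` (the integrand is `≤ 1/(ν(1/2-ν))` on an interval
  of length `1/2 - 2ν`; in fact `M = 4 log(84/41) ≈ 2.87`);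
* `T22_ge_0164` — `T₂₂ ≥ -M²/4 ≥ -4` (`w₂(u)w₂(v) = 𝟙/(4u₀u₁v₀v₁) ≥ 0` and `F₀⁽⁴⁾ ≥ -1`);
* `hhalf_0164` — **`fragOp (1/2) (41/250) F₀ (1/2, 1/2) ≥ -1`** for data `F₀` piecewise Lipschitz in each
  dimension, supported on `{ξᵢ ≥ 41/250, Σ ξ = 1}`, with `F₀⁽⁴⁾ ≥ -1`, `F₀⁽⁵⁾ ≥ 0`, `F₀⁽⁶⁾ = 0`.

Def-free.  References: [FordMaynard2024PrimeSieves] arXiv:2407.14368, §6.1 (6.3), §8 (proof of Thm 2.7 (c)).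
-/

noncomputable section

open Finset MeasureTheory Set
open scoped Classical
open Literature.Combinatorics.Enumerative
open Literature.NumberTheory.Sieve Literature.NumberTheory.Sieve.FordMaynard

namespace Summit.Parity.GeneralizedHardyLittlewood.FordMaynardNoSieveConst0164NegWitness0164

/-- The kernel `𝟙[v ≥ 41/250]/(v₀v₁)` on `ℝ²` is nonnegative. [folklore] -/
theorem K_nonneg_0164 (v : Fin 2 → ℝ) :
    0 ≤ (if ∀ i, (41 / 250 : ℝ) ≤ v i then 1 / (v 0 * v 1) else 0) := by
  split_ifs with h
  · have h0 := h 0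
    have h1 := h 1
    positivity
  · exact le_rfl

/-- The kernel `𝟙[v ≥ 41/250]/(v₀v₁)` is bounded by `(250/41)²`. [folklore] -/
theorem K_le_0164 (v : Fin 2 → ℝ) :
    (if ∀ i, (41 / 250 : ℝ) ≤ v i then 1 / (v 0 * v 1) else 0) ≤ (250 / 41) ^ 2 := by
  split_ifs with h
  · have h0 := h 0
    have h1 := h 1
    rw [div_le_iff₀ (by positivity)]
    nlinarith [mul_le_mul h0 h1 (by norm_num) (by linarith)]
  · positivity

/-- The kernel `𝟙[v ≥ 41/250]/(v₀v₁)` is measurable. [folklore] -/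
theorem measurable_K_0164 :
    Measurable (fun v : Fin 2 → ℝ => if ∀ i, (41 / 250 : ℝ) ≤ v i then 1 / (v 0 * v 1) else 0) := by
  refine Measurable.ite ?_ (measurable_const.div ((measurable_pi_apply 0).mul (measurable_pi_apply 1)))
    measurable_const
  have h : {v : Fin 2 → ℝ | ∀ i, (41 / 250 : ℝ) ≤ v i} = ⋂ i, {v | (41 / 250 : ℝ) ≤ v i} := by
    ext v; simp
  rw [h]
  exact MeasurableSet.iInter fun i => measurableSet_le measurable_const (measurable_pi_apply i)

/-- **On `Δ₂(1/2)` the two-piece weight is `-𝟙/(2v₀v₁)` on vectors with entries `≥ ν`**: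
`𝟙[v ≥ ν] w₂(v) = -(1/2) 𝟙[v ≥ ν]/(v₀v₁)`. [cite: FordMaynard2024PrimeSieves, §8 ("if k = 2 then 𝓛_{1/2}(u) = −1")] -/
theorem indicator_blockWeight_two_eq_0164 (v : Fin 2 → ℝ) (hpos : ∀ i, 0 < v i) (hs : ∑ i, v i = 1 / 2)
    (hv : ∀ i, (41 / 250 : ℝ) ≤ v i) :
    blockWeight (1 / 2) 2 v = -(1 / 2) * (if ∀ i, (41 / 250 : ℝ) ≤ v i then 1 / (v 0 * v 1) else 0) := by
  rw [if_pos hv, Fin.sum_univ_two] at *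
  have h0 := hpos 0
  have h1 := hpos 1
  rw [blockWeight_two_eq v (by linarith) (by linarith) (by linarith)]
  have : v 0 * v 1 ≠ 0 := by positivity
  field_simp

/-- For `u : Fin 1 → ℝ`, `Fin.snoc u s = (u 0, s)`. [folklore] -/
theorem snoc_fin_one_eq (u : Fin 1 → ℝ) (s : ℝ) : (Fin.snoc u s : Fin 2 → ℝ) = ![u 0, s] := by
  ext i
  fin_cases i
  · rfl
  · rfl

/-- **`M = ∫_{v ∈ Δ₂(1/2)} 𝟙[v ≥ 41/250]/(v₀v₁) ≤ 4`.** On the slice the integrand is supported on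
`v₀ ∈ [ν, 1/2 - ν]` and bounded there by `1/(ν(1/2-ν))`, `ν = 41/250`, so
`M ≤ (62500/3444)·(43/250) < 4` (exactly, `M = 4 log(84/41) ≈ 2.87`). [folklore] -/
theorem M_le_0164 :
    sliceIntegral 2 (1 / 2) (fun v => if ∀ i, (41 / 250 : ℝ) ≤ v i then 1 / (v 0 * v 1) else 0) ≤ 4 := by
  set S : Set (Fin 1 → ℝ) := Set.pi Set.univ fun _ => Icc (41 / 250 : ℝ) (1 / 2 - 41 / 250) with hS
  set f : (Fin 1 → ℝ) → ℝ := fun u => if (∀ i, 0 < u i) ∧ ∑ i, u i < 1 / 2 then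
    (fun v : Fin 2 → ℝ => if ∀ i, (41 / 250 : ℝ) ≤ v i then 1 / (v 0 * v 1) else 0)
      (Fin.snoc u (1 / 2 - ∑ i, u i)) else 0 with hf
  have hdef : sliceIntegral 2 (1 / 2) (fun v => if ∀ i, (41 / 250 : ℝ) ≤ v i then 1 / (v 0 * v 1) else 0) =
      ∫ u, f u := rfl
  have hval : ∀ u : Fin 1 → ℝ, f u = if (0 < u 0 ∧ u 0 < 1 / 2) ∧ ((41 / 250 : ℝ) ≤ u 0 ∧
      (41 / 250 : ℝ) ≤ 1 / 2 - u 0) then 1 / (u 0 * (1 / 2 - u 0)) else 0 := by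
    intro u
    simp only [hf, Fin.sum_univ_one, Fin.forall_fin_one, snoc_fin_one_eq, Fin.forall_fin_two,
      Matrix.cons_val_zero, Matrix.cons_val_one]
    by_cases h1 : 0 < u 0 ∧ u 0 < 1 / 2
    · by_cases h2 : (41 / 250 : ℝ) ≤ u 0 ∧ (41 / 250 : ℝ) ≤ 1 / 2 - u 0
      · rw [if_pos h1, if_pos h2, if_pos ⟨h1, h2⟩]
      · rw [if_pos h1, if_neg h2, if_neg (fun h => h2 h.2)]
    · rw [if_neg h1, if_neg (fun h => h1 h.1)]
  have hsupp : ∀ u, u ∉ S → f u = 0 := by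
    intro u hu
    rw [hval, if_neg]
    rintro ⟨-, h2, h3⟩
    apply hu
    rw [hS, Set.mem_univ_pi]
    intro i
    rw [Subsingleton.elim i 0]
    exact ⟨h2, by linarith⟩
  have hbound : ∀ u ∈ S, ‖f u‖ ≤ 62500 / 3444 := by
    intro u hu
    rw [hS, Set.mem_univ_pi] at hu
    obtain ⟨h1, h2⟩ := hu 0
    rw [hval, Real.norm_eq_abs]
    split_ifs
    · rw [abs_of_pos (by apply div_pos one_pos; nlinarith), div_le_iff₀ (by nlinarith)]
      nlinarith
    · norm_num
  have hvol : volume S = ENNReal.ofReal (43 / 250) := by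
    rw [hS, volume_pi_pi]
    simp only [Real.volume_Icc, Finset.prod_const, Finset.card_univ, Fintype.card_fin, pow_one]
    norm_num
  have hfin : volume S < ⊤ := by rw [hvol]; exact ENNReal.ofReal_lt_top
  rw [hdef, ← setIntegral_eq_integral_of_forall_compl_eq_zero (s := S) (fun u hu => hsupp u hu)]
  have hb := norm_setIntegral_le_of_norm_le_const hfin hbound
  rw [Real.norm_eq_abs] at hb
  have hμ : volume.real S = 43 / 250 := by
    simp only [Measure.real, hvol, ENNReal.toReal_ofReal (by norm_num : (0 : ℝ) ≤ 43 / 250)]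
  rw [hμ] at hb
  have := le_of_abs_le hb
  linarith

/-- `M ≥ 0`. [folklore] -/
theorem M_nonneg_0164 :
    0 ≤ sliceIntegral 2 (1 / 2) (fun v => if ∀ i, (41 / 250 : ℝ) ≤ v i then 1 / (v 0 * v 1) else 0) :=
  sliceIntegral_nonneg_of _ _ _ fun v _ _ => K_nonneg_0164 v

/-- The set `{v ≥ ν}` in `ℝ²` paired with a parameter condition is measurable. [folklore] -/
theorem measurableSet_cond_0164 (P : Prop) :
    MeasurableSet {v : Fin 2 → ℝ | P ∧ ∀ i, (41 / 250 : ℝ) ≤ v i} := by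
  have h : {v : Fin 2 → ℝ | P ∧ ∀ i, (41 / 250 : ℝ) ≤ v i} =
      {_v | P} ∩ ⋂ i, {v : Fin 2 → ℝ | (41 / 250 : ℝ) ≤ v i} := by
    ext v; simp
  rw [h]
  exact (MeasurableSet.const P).inter
    (MeasurableSet.iInter fun i => measurableSet_le measurable_const (measurable_pi_apply i))

/-- Joint measurability of the `(2,2)` integrand at `(1/2, 1/2)`. [folklore] -/
theorem measurable_G22_0164 {F₀ : VecFn} (hpl : ∀ k, IsPiecewiseLipschitz (F₀ k)) :
    Measurable (fun q : (Fin 2 → ℝ) × (Fin 2 → ℝ) =>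
      if (∀ t, (41 / 250 : ℝ) ≤ q.1 t) ∧ (∀ i, (41 / 250 : ℝ) ≤ q.2 i) then
        blockWeight (1 / 2) 2 q.1 * blockWeight (1 / 2) 2 q.2 * F₀ (2 + 2) (Fin.append q.1 q.2) else 0) := by
  refine Measurable.ite ?_ ?_ measurable_const
  · have h : {q : (Fin 2 → ℝ) × (Fin 2 → ℝ) | (∀ t, (41 / 250 : ℝ) ≤ q.1 t) ∧ ∀ i, (41 / 250 : ℝ) ≤ q.2 i} =
        (⋂ t, {q | (41 / 250 : ℝ) ≤ q.1 t}) ∩ ⋂ i, {q | (41 / 250 : ℝ) ≤ q.2 i} := by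
      ext q; simp
    rw [h]
    refine MeasurableSet.inter (MeasurableSet.iInter fun t => ?_) (MeasurableSet.iInter fun i => ?_)
    · exact measurableSet_le measurable_const
        ((measurable_pi_apply t).comp (measurable_fst : Measurable
          (Prod.fst : (Fin 2 → ℝ) × (Fin 2 → ℝ) → Fin 2 → ℝ)))
    · exact measurableSet_le measurable_const
        ((measurable_pi_apply i).comp (measurable_snd : Measurable
          (Prod.snd : (Fin 2 → ℝ) × (Fin 2 → ℝ) → Fin 2 → ℝ)))
  · exact (((measurable_blockWeight _ _).comp measurable_fst).mul
      ((measurable_blockWeight _ _).comp measurable_snd)).mul ((hpl _).measurable.comp measurable_finAppend)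

/-- **`T₂₂ ≥ -4`.** For data `F₀` piecewise Lipschitz in each dimension, supported on
`{ξᵢ ≥ 41/250, Σ ξ = 1}`, with `F₀⁽⁴⁾ ≥ -1`: since `𝟙 w₂(u) w₂(v) = 𝟙/(4u₀u₁v₀v₁) ≥ 0`,
`T₂₂ ≥ -M²/4 ≥ -4` (`M ≤ 4`, `M_le_0164`). [cite: FordMaynard2024PrimeSieves, §8 (proof of Theorem 2.7 (c))] -/
theorem T22_ge_0164 {F₀ : VecFn} (hpl : ∀ k, IsPiecewiseLipschitz (F₀ k))
    (hsupp : ∀ (k : ℕ) (ξ : Fin k → ℝ), F₀ k ξ ≠ 0 → (∀ i, (41 / 250 : ℝ) ≤ ξ i) ∧ ∑ i, ξ i = 1)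
    (h4 : ∀ x : Fin 4 → ℝ, -1 ≤ F₀ 4 x) :
    -4 ≤ sliceIntegral 2 (1 / 2) (fun u => sliceIntegral 2 (1 / 2) (fun v =>
      if (∀ t, (41 / 250 : ℝ) ≤ u t) ∧ (∀ i, (41 / 250 : ℝ) ≤ v i) then
        blockWeight (1 / 2) 2 u * blockWeight (1 / 2) 2 v * F₀ (2 + 2) (Fin.append u v) else 0)) := by
  obtain ⟨F, hF⟩ := exists_uniform_bound_of_support (by norm_num) hpl hsupp
  have hF0 : 0 ≤ F := (abs_nonneg _).trans (hF 0 Fin.elim0)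
  -- notation
  set K : (Fin 2 → ℝ) → ℝ := fun v => if ∀ i, (41 / 250 : ℝ) ≤ v i then 1 / (v 0 * v 1) else 0 with hK
  set M : ℝ := sliceIntegral 2 (1 / 2) K with hM
  have hM0 : 0 ≤ M := M_nonneg_0164
  have hM4 : M ≤ 4 := M_le_0164
  have hKb : ∀ v, |K v| ≤ (250 / 41) ^ 2 := fun v => by
    rw [abs_of_nonneg (K_nonneg_0164 v)]; exact K_le_0164 v
  set G : (Fin 2 → ℝ) → (Fin 2 → ℝ) → ℝ := fun u v =>
    if (∀ t, (41 / 250 : ℝ) ≤ u t) ∧ (∀ i, (41 / 250 : ℝ) ≤ v i) then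
      blockWeight (1 / 2) 2 u * blockWeight (1 / 2) 2 v * F₀ (2 + 2) (Fin.append u v) else 0 with hG
  -- Step 1: on the slices, `G u v = (K u K v / 4) F₀(u,v) ≥ -(K u / 4) K v`, and `|G u v| ≤ C`
  set C : ℝ := (250 / 41) ^ 4 * (F + 1) with hC
  have hC0 : 0 ≤ C := by positivity
  have hstep1 : ∀ u : Fin 2 → ℝ, (∀ i, 0 < u i) → ∑ i, u i = 1 / 2 → ∀ v : Fin 2 → ℝ, (∀ i, 0 < v i) →
      ∑ i, v i = 1 / 2 → 0 ≤ G u v + K u / 4 * K v ∧ |G u v| ≤ C := by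
    intro u hu hus v hv hvs
    have hKu := K_nonneg_0164 u
    have hKv := K_nonneg_0164 v
    have hKu' := K_le_0164 u
    have hKv' := K_le_0164 v
    simp only [hG]
    by_cases hc : (∀ t, (41 / 250 : ℝ) ≤ u t) ∧ (∀ i, (41 / 250 : ℝ) ≤ v i)
    · rw [if_pos hc, indicator_blockWeight_two_eq_0164 u hu hus hc.1,
        indicator_blockWeight_two_eq_0164 v hv hvs hc.2]
      have hFx := h4 (Fin.append u v)
      have hFx' : |F₀ (2 + 2) (Fin.append u v)| ≤ F := hF _ _
      have hFx'' := (abs_le.1 hFx').2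
      refine ⟨?_, ?_⟩
      · have : 0 ≤ K u * K v * (F₀ (2 + 2) (Fin.append u v) + 1) :=
          mul_nonneg (mul_nonneg hKu hKv) (by linarith)
        nlinarith
      · rw [abs_le]
        constructor
        · nlinarith [mul_nonneg hKu hKv, mul_le_mul hKu' hKv' hKv (by positivity)]
        · nlinarith [mul_nonneg hKu hKv, mul_le_mul hKu' hKv' hKv (by positivity)]
    · rw [if_neg hc, abs_zero]
      exact ⟨by positivity, hC0⟩
  -- Step 2: the inner integrals `I u ≥ -(K u / 4) M`, and `|I u| ≤ C / 2`
  have hGm : ∀ u, Measurable (G u) := fun u =>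
    (measurable_G22_0164 hpl).comp (measurable_const.prodMk measurable_id)
  have hstep2 : ∀ u : Fin 2 → ℝ, (∀ i, 0 < u i) → ∑ i, u i = 1 / 2 →
      0 ≤ sliceIntegral 2 (1 / 2) (G u) + M / 4 * K u := by
    intro u hu hus
    have hadd := sliceIntegral_add 1 (1 / 2) (hGm u) (measurable_K_0164.const_mul (K u / 4))
      (C := C + (250 / 41) ^ 2 * (250 / 41) ^ 2) (by positivity)
      (fun v hv hvs => ((hstep1 u hu hus v hv hvs).2).trans (by nlinarith))
      (fun v hv hvs => by
        rw [abs_mul, abs_of_nonneg (by linarith [K_nonneg_0164 u] : 0 ≤ K u / 4)]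
        nlinarith [hKb v, K_nonneg_0164 u, K_le_0164 u, abs_nonneg (K v)])
    have hnn : 0 ≤ sliceIntegral 2 (1 / 2) (fun v => G u v + K u / 4 * K v) :=
      sliceIntegral_nonneg_of _ _ _ fun v hv hvs => (hstep1 u hu hus v hv hvs).1
    rw [hadd, sliceIntegral_const_mul] at hnn
    linarith
  -- Step 3: the outer integral
  have hIm : Measurable (fun u : Fin 2 → ℝ => sliceIntegral 2 (1 / 2) (G u)) :=
    measurable_sliceIntegral_param 2 measurable_const (measurable_G22_0164 hpl)
  have hIb : ∀ u : Fin 2 → ℝ, (∀ i, 0 < u i) → ∑ i, u i = 1 / 2 →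
      |sliceIntegral 2 (1 / 2) (G u)| ≤ C * (1 / 2) ^ 1 := fun u hu hus =>
    abs_sliceIntegral_le 1 (by norm_num) hC0 fun v hv hvs => (hstep1 u hu hus v hv hvs).2
  have hadd := sliceIntegral_add 1 (1 / 2) hIm (measurable_K_0164.const_mul (M / 4))
    (C := C * (1 / 2) ^ 1 + (250 / 41) ^ 2) (by positivity)
    (fun u hu hus => (hIb u hu hus).trans (by nlinarith))
    (fun u hu hus => by
      rw [abs_mul, abs_of_nonneg (by linarith : 0 ≤ M / 4)]
      nlinarith [hKb u, abs_nonneg (K u)])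
  have hnn : 0 ≤ sliceIntegral 2 (1 / 2) (fun u => sliceIntegral 2 (1 / 2) (G u) + M / 4 * K u) :=
    sliceIntegral_nonneg_of _ _ _ fun u hu hus => hstep2 u hu hus
  rw [hadd, sliceIntegral_const_mul] at hnn
  show -4 ≤ sliceIntegral 2 (1 / 2) (fun u => sliceIntegral 2 (1 / 2) (G u))
  nlinarith

/-- **Hypothesis (iii) of `stub_tweakNeg0164_of_shape`, discharged**: for data `F₀` piecewise Lipschitz in
each dimension, supported on `{ξᵢ ≥ 41/250, Σ ξ = 1}`, with `F₀⁽⁴⁾ ≥ -1`, `F₀⁽⁵⁾ ≥ 0` and `F₀⁽⁶⁾ = 0`,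
`fragOp (1/2) (41/250) F₀ (1/2, 1/2) ≥ -1` (the cell's (F3): `f(1/2, 1/2) ≥ -1`).
[cite: FordMaynard2024PrimeSieves, §8 (proof of Theorem 2.7 (c))] -/
theorem hhalf_0164 {F₀ : VecFn} (hpl : ∀ k, IsPiecewiseLipschitz (F₀ k))
    (hsupp : ∀ (k : ℕ) (ξ : Fin k → ℝ), F₀ k ξ ≠ 0 → (∀ i, (41 / 250 : ℝ) ≤ ξ i) ∧ ∑ i, ξ i = 1)
    (h4 : ∀ x : Fin 4 → ℝ, -1 ≤ F₀ 4 x) (h5 : ∀ x : Fin 5 → ℝ, 0 ≤ F₀ 5 x)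
    (h6 : ∀ x : Fin 6 → ℝ, F₀ 6 x = 0) :
    -1 ≤ fragOp (1 / 2) (41 / 250) F₀ 2 (fun _ => 1 / 2) :=
  hhalf_of_T22_0164 hpl hsupp h5 h6 (T22_ge_0164 hpl hsupp h4)

end Summit.Parity.GeneralizedHardyLittlewood.FordMaynardNoSieveConst0164NegWitness0164

end
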